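import Summits.CriticalPhenomena.PercolationContinuityZ3.Theses.PercNonProliferation
import Summits.CriticalPhenomena.PercolationContinuityZ3.Theorems.PercNearOneGluingNoHeavyLowerTailCSHTheoremOne
import Summits.CriticalPhenomena.PercolationContinuityZ3.Theorems.FreeBoxSparse.Negative.OfContinuity
import HarnessLib

/-!
# `PercNonProliferation.FreeBoxSparse` (stmt-CriticalPhenomena-4445) — SETTLED after continuity

Item `stmt-CriticalPhenomena-4445` of route `CriticalPhenomena/PercNonProliferation` (crux): at `p_c(ℤ³)` the free-box two-point average `|Λ_n|⁻² Σ_{x,y∈Λ_n} P(x ↔ y in Λ_n) → 0`.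

The tree's `FreeBoxSparse.Negative.not_percolationContinuityZ3_of_not_freeBoxSparse` (`¬C → ¬S`, one-arm/Cesàro) is contraposed against p205010.

builds on p205010 (kernel theorem, internal audit signed; external expert review pending) — USED (`CSH.percolationContinuityZ3_holds`).  RSW3 lane, lead gen 28 (prover-prim-rsw3-lead-g28-0):
'after continuity — the ledger harvest'.
References: G. Kozma, N. Nitzan (2024), Thm. 6 / Conj. 3 [KozmaNitzan2024]; G. Grimmett, *Percolation* (1999), §8 [GrimmettPercolation1999].
-/

noncomputable section

namespace Summit.CriticalPhenomena.PercolationContinuityZ3.Theorems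

namespace PercNonProliferationFreeBoxSparse

open MeasureTheory Literature.Probability.Percolation Literature.Probability.LatticeModels

/-- **`PercNonProliferation.FreeBoxSparse` (stmt-CriticalPhenomena-4445), settled.**  contrapositive of `FreeBoxSparse.Negative.not_percolationContinuityZ3_of_not_freeBoxSparse` at p205010.
[cite: KozmaNitzan2024, Thm. 6 with Conj. 3 (p. 15)] -/
theorem freeBoxSparse_proof : Summit.CriticalPhenomena.PercolationContinuityZ3.Theses.PercNonProliferation.FreeBoxSparse := by
  by_contra hC
  exact FreeBoxSparse.Negative.not_percolationContinuityZ3_of_not_freeBoxSparse hC CSH.percolationContinuityZ3_holds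

end PercNonProliferationFreeBoxSparse

end Summit.CriticalPhenomena.PercolationContinuityZ3.Theorems

end
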